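import Literature.Algebra.EuclideanLattices.BabaiNearestPlane
import HarnessLib

/-!
# Babai's nearest-plane coefficients by back-substitution against the fixed Gram–Schmidt vectors

Topic `Algebra/EuclideanLattices` (family `pqc`), sequel of `BabaiNearestPlane.lean` (`Babai.nearestPlane k f c`:
peel the LAST vector, `z_{k-1} = ⌊⟪c, b̃_{k-1}⟫/‖b̃_{k-1}‖²⌉`, recurse on `c - z_{k-1} b_{k-1}` with the prefix
family). Everything here is PROVED; no definition, no named fact.

The recursion changes the TARGET at every step. For a machine (the first component of Peikert's
`GapSVP → LWE` reduction hands the BDD solver Babai's residual of the perturbation, pqc.S20,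
`Cryptography/PeikertReduction.lean`) it is better to keep the target and the Gram–Schmidt vectors FIXED
and back-substitute: since the prefix family has the same Gram–Schmidt vectors
(`gramSchmidt_comp_castSucc`) and `⟪c - z bᵢ, b̃ⱼ⟫ = ⟪c, b̃ⱼ⟫ - z ⟪bᵢ, b̃ⱼ⟫`,

  `zⱼ = ⌊(⟪c, b̃ⱼ⟫ - ∑_{i > j} zᵢ ⟪bᵢ, b̃ⱼ⟫) / ‖b̃ⱼ‖²⌉`   (`j = k-1, k-2, …, 0`),

which is Babai's procedure as printed (Babai 1986, §3: "for `j = n, n-1, …, 1` … the nearest hyperplane")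
and, after multiplication by Cohen's `dⱼ`, an identity between INTEGERS of the Gram–Schmidt table of the
extended family `(b, c)` (`LLLIntegral.lean`, `BabaiIntegral.lean`): numerator
`λ_{c,j} - ∑_{i>j} zᵢ λ_{i,j}`, denominator `d_{j+1}`.

* `Babai.inner_sub_smul_gramSchmidt` — `⟪c - z bᵢ, b̃ⱼ⟫ = ⟪c, b̃ⱼ⟫ - z ⟪bᵢ, b̃ⱼ⟫`;
* **`Babai.nearestPlane_eq_round_backSub`** — the displayed identity for every `j`.

## References

* L. Babai, *On Lovász' lattice reduction and the nearest lattice point problem*, Combinatorica 6 (1986)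
  1–13, §3 (procedure NEAREST PLANE, stated with the fixed orthogonalised basis `b*ⱼ`) [Babai1986].
* H. Cohen, *A Course in Computational Algebraic Number Theory*, GTM 138, Springer 1993, §2.6.3
  (`λᵢⱼ = dⱼ μᵢⱼ`, `d_{j+1} = dⱼ ‖b*ⱼ‖²`) [Cohen1993].
-/

noncomputable section

open Finset InnerProductSpace
open scoped RealInnerProductSpace

namespace Literature.Algebra.EuclideanLattices

variable {V : Type*} [NormedAddCommGroup V] [InnerProductSpace ℝ V]

namespace Babai

open GPVSampler

/-- `⟪c - z • b, g⟫ = ⟪c, g⟫ - z ⟪b, g⟫`. [folklore] -/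
theorem inner_sub_smul_gramSchmidt (c b g : V) (z : ℤ) :
    ⟪c - (z : ℝ) • b, g⟫ = ⟪c, g⟫ - (z : ℝ) * ⟪b, g⟫ := by
  rw [inner_sub_left, real_inner_smul_left]

/-- The back-substitution numerator: `⟪c, b̃ⱼ⟫ - ∑_{i > j} zᵢ ⟪bᵢ, b̃ⱼ⟫`. [cite: Babai1986, §3] -/
theorem backSub_numerator_def {k : ℕ} (f : Fin k → V) (c : V) (z : Fin k → ℤ) (j : Fin k) :
    (⟪c, gramSchmidt ℝ f j⟫ - ∑ i, if j < i then (z i : ℝ) * ⟪f i, gramSchmidt ℝ f j⟫ else 0) =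
      ⟪c, gramSchmidt ℝ f j⟫ - ∑ i ∈ univ.filter (fun i => j < i), (z i : ℝ) * ⟪f i, gramSchmidt ℝ f j⟫ := by
  rw [Finset.sum_filter]

/-- **Babai's coefficients by back-substitution against the fixed Gram–Schmidt vectors**: for every `j`,
`zⱼ = ⌊(⟪c, b̃ⱼ⟫ - ∑_{i > j} zᵢ ⟪bᵢ, b̃ⱼ⟫)/‖b̃ⱼ‖²⌉` where `z = nearestPlane k f c` and `b̃ = gramSchmidt ℝ f`.
[cite: Babai1986, §3 (procedure NEAREST PLANE)] -/
theorem nearestPlane_eq_round_backSub : ∀ (k : ℕ) (f : Fin k → V) (c : V) (j : Fin k),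
    nearestPlane k f c j =
      round ((⟪c, gramSchmidt ℝ f j⟫ -
        ∑ i, if j < i then (nearestPlane k f c i : ℝ) * ⟪f i, gramSchmidt ℝ f j⟫ else 0) /
        ‖gramSchmidt ℝ f j‖ ^ 2)
  | 0, _, _, j => j.elim0
  | k + 1, f, c, j => by
      set z : ℤ := round (lastCenter f c) with hz
      set c' : V := c - (z : ℝ) • f (Fin.last k) with hc'
      have hsucc : nearestPlane (k + 1) f c = Fin.snoc (nearestPlane k (f ∘ Fin.castSucc) c') z := by
        rw [nearestPlane_succ]
      have hprefix : ∀ i : Fin k, gramSchmidt ℝ (f ∘ Fin.castSucc) i = gramSchmidt ℝ f (Fin.castSucc i) :=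
        fun i => Literature.Analysis.InnerProduct.gramSchmidt_comp_castSucc ℝ f i
      induction j using Fin.lastCases with
      | last =>
          -- no `i > last`: the sum vanishes and the formula is `round (lastCenter f c)`
          have hsum : (∑ i : Fin (k + 1), if Fin.last k < i then
              (nearestPlane (k + 1) f c i : ℝ) * ⟪f i, gramSchmidt ℝ f (Fin.last k)⟫ else 0) = 0 := by
            refine Finset.sum_eq_zero fun i _ => ?_
            rw [if_neg (not_lt.2 (Fin.le_last i))]
          rw [hsum, sub_zero, hsucc, Fin.snoc_last, hz, lastCenter]
      | cast j =>
          -- the recursive call on the prefix family with the shifted target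
          have ih := nearestPlane_eq_round_backSub k (f ∘ Fin.castSucc) c' j
          rw [hsucc, Fin.snoc_castSucc, ih]
          congr 1
          simp only [hprefix, Function.comp_apply]
          rw [hc', inner_sub_smul_gramSchmidt]
          -- split the sum over `Fin (k+1)` into `castSucc` terms and the `last` term
          rw [Fin.sum_univ_castSucc]
          simp only [Fin.snoc_castSucc, Fin.snoc_last, Fin.castSucc_lt_castSucc_iff,
            if_pos (Fin.castSucc_lt_last j)]
          ring
end Babai

end Literature.Algebra.EuclideanLattices

end
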